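/-
Copyright (c) 2026 the pub-hodgecm-mathlib formalisation cell (harness21).  Prover seat hodgecm-mathlib-LH4-p14 (g5), req620 Track A «(D-RAM) FOUR-FRAME» squad
(unit U2H_HSide, the (ρ2b′-X) road :418; payer by lineage LH4-p14 (g3) → (g4) → (g5)).
-/
import Summits.HodgeConjecture.HodgeConjecture.Theorems.F0P3cDyRamFixedPointCensusTypeTwoPointwise              -- ★ p857404 (LH4-p14 (g4)): `fixedPointCensus_typeTwo_unit0_at_of_signedCensusNV_at` (layer 4′, brings ★ Prelude p857439)
import Summits.HodgeConjecture.HodgeConjecture.Theorems.F0P3cDyRamFixedPointCensusTypeTwoOfOrgansV3            -- ★ p857919 (LH4-p14 (g4)): `hOrgNV_at_of_census3` ((A′) by name ★ p857702)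
import Summits.HodgeConjecture.HodgeConjecture.Theorems.F0P3cDyRamFixedPointCensusTypeTwoCensusOfFrameV3       -- ★ p857920 (LH4-p14 (g4)): `hCensus3_at_of_frameCensus3`
import Summits.HodgeConjecture.HodgeConjecture.Theorems.F0P3cDyRamFixedPointCensusTypeTwoCensusOfLineModelsV3  -- ★ p857921 (LH4-p14 (g4)): `frameCensus3_of_lineModelCensus2`
import Summits.HodgeConjecture.HodgeConjecture.Theorems.F0P3cDyRamFixedPointCensusTypeTwoCensusOfLineModelsFin -- ★ p857922 (LH4-p14 (g4)): `lineModelCensus_of_lineModelCensusFin`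
import Summits.HodgeConjecture.HodgeConjecture.Theorems.F0P3cDyRamFixedPointCensusTypeTwoCensusOfOrderFormsV3  -- ★ p857871 (LH4-p11 (g5)): `lineModelCensus3_of_orderFormCensus3`
import Summits.HodgeConjecture.HodgeConjecture.Theorems.F0P3cDyRamFixedPointCensusTypeTwoCensusOfOrderCountsV3 -- ★ p857872 (LH4-p11 (g5)): `orderFormCensus3_of_orderCountCensus2`
import Summits.HodgeConjecture.HodgeConjecture.Theorems.F0P3cDyRamFixedPointCensusTypeTwoTypeSplit             -- ★ p857960 (LH4-p14 (g4)): `orderCountCensus2_of_types (hA) (hB) (hC)`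
import Summits.HodgeConjecture.HodgeConjecture.Theorems.F0P3cDyRamOrderCountCensusUnr   -- ★ bottom (A) U-unrK (LH4-p11 (g5)): `orderCountCensusA`
import Summits.HodgeConjecture.HodgeConjecture.Theorems.F0P3cDyRamOrderCountCensusRamK  -- ★ bottom (B) U-ramK (LH4-p07 (g7) + LH4-p12∕p13 + F0P3-p01): `orderCountCensusB`
import Summits.HodgeConjecture.HodgeConjecture.Theorems.F0P3cDyRamOrderCountCensusRamM  -- ★ bottom (C) RamM (LH4-p04 (g5) + LH4-p06 + F0P3a-p01): `orderCountCensusC`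
import HarnessLib

/-!
# F0 · P3c · line LH4 «(D-RAM) FOUR-FRAME» — unit (ii-H), leaf (ρ2b′-X): THE TYPE-(2) FIXED-POINT CENSUS LAW AT THE ANCHOR — THE FINAL HEAD
(Rogawski 1990 §4.9; Kottwitz 1986 §1; Labesse–Langlands 1979 §2; Serre 1979 Ch. V §3)

Cell `pub/hodgecm-mathlib`, crux H413 = `stmt-HodgeConjecture-24833` (helper lane, count-neutral); THEOREMS ONLY (no definition, no instance, no notation, no named fact,
no `sorry`), typed under the LINE FILE's `open` block (`Cruxes/H413/Lines/F0_P3c_DyRamFourFrame_U2H_HSide.lean` ED. 15, `ValuativeRel` scoped: the `_h2` letter reads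
`¬ IsUnit (2 : 𝒪[L_w])` in the valuative-relation spelling, exactly as at :418).

WHAT IS PROVED: **`fixedPointCensus_typeTwo_unit0`** — the statement of the registered stub `F0P3cDyRamFourFrameU2H.stub_U2H_fixedPointCensus_typeTwo_unit0` (U2H :418)
TOKEN FOR TOKEN: near `1 ∈ H_v`, for every `G`-regular TYPE-(2) `γ_H`, every depth token `m` and symmetrised discriminant `β`, and every pair of matches `δ₊, δ₋` of
κ-signs `+1, −1`, `(β, θ)_v · q_v^{−m} · (#Fix_{δ₊}(G_v ⧸ K_t) − #Fix_{δ₋}(G_v ⧸ K_t)) = #Fix_{γ₂}(U₂ ⧸ K_H) + d % 2 − 2(q_w^S − 1)∕(q_w − 1)` (`S = shiftR d t_E`).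

PROOF = THE (ρ2b′-X) PAY LINE (MAP v3 of the payer lineage), a composition of ★ tree theorems and nothing else:
★ `…Pointwise.fixedPointCensus_typeTwo_unit0_at_of_signedCensusNV_at` (layer 4′: signed lattice census ⟹ the law, pointwise in `(N, K_t)`)
∘ ★ `…OfOrgansV3.hOrgNV_at_of_census3` (the organs: eigen-field package, literal letters with (A′) by name, H-side vertex count)
∘ ★ `…CensusOfFrameV3.hCensus3_at_of_frameCensus3` (the four-frame of a type-(2) class) ∘ ★ `…CensusOfLineModelsV3.frameCensus3_of_lineModelCensus2` (the two line models)
∘ ★ `…CensusOfLineModelsFin.lineModelCensus_of_lineModelCensusFin` (finiteness + tube bounds) ∘ ★ `…CensusOfOrderFormsV3.lineModelCensus3_of_orderFormCensus3` (order forms, ★ (C1))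
∘ ★ `…CensusOfOrderCountsV3.orderFormCensus3_of_orderCountCensus2` (cone weights summed, ★ (β); its `h2v : |2|_w < 1` is :418's own `_h2` read through
`Valuation.Integer.not_isUnit_iff_valuation_lt_one` and the `Valued`∕`ValuativeRel` compatibility `Valuation.vlt_one_iff`)
∘ ★ `…TypeSplit.orderCountCensus2_of_types` (split by the descent type of the line model `M = E′_{w₁}` over `L_w`)
applied to the three ★ typed order-count censuses (A) U-unrK, (B) U-ramK, (C) RamM (imported by name; see the import lines).

HONEST LABEL: HC_CM is proved only modulo the 7 printed citations (2 remaining named inputs: hLiu418 = stmt-HodgeConjecture-24832, h413 = stmt-HodgeConjecture-24833) until rung 0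
closes; this file is `--supports stmt-HodgeConjecture-24833 --as helper` (count-neutral).  It pays U2H :418 BY NAME once the pen writes ED. 16 (`stub_… := ‹this constant›`).

## References
* [Rogawski1990] J. D. Rogawski, *Automorphic Representations of Unitary Groups in Three Variables*, Ann. of Math. Stud. 123 (1990), §4.9 Prop. 4.9.1 (b) p. 55, Lemma 4.9.3 p. 56.
* [Kottwitz1986BaseChangeUnits] R. E. Kottwitz, *Base change for unit elements of Hecke algebras*, Compositio Math. 60 (1986), §1 pp. 240–241.
* [LabesseLanglands1979] J.-P. Labesse, R. P. Langlands, *L-indistinguishability for SL(2)*, Canad. J. Math. 31 (1979), §2 p. 8.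
* [Serre1979] J.-P. Serre, *Local Fields*, GTM 67 (1979), Ch. II §1; Ch. V §3 Prop. 5, Cor. 2–3 pp. 84–86.
-/

set_option autoImplicit false

noncomputable section

namespace Summit.HodgeConjecture.HodgeConjecture.Cruxes.H413.F0P3cDyRamFixedPointCensusTypeTwo

-- THE LINES MODULE'S `open` CONTEXT (tree `Cruxes/H413/Lines/F0_P3c_DyRamFourFrame_U2H_HSide.lean` ED. 15, after its `namespace`), `ValuativeRel` scoped INCLUDED:
open MeasureTheory Measure NumberField IsDedekindDomain Topology Filter
open Literature.NumberTheory.Automorphic Literature.NumberTheory.Automorphic.UnitaryGroup Literature.NumberTheory.Automorphic.IntegralReduction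
open Literature.NumberTheory.Rogawski1990 Literature.NumberTheory.GaloisRepresentations
open Literature.NumberTheory.Automorphic.UnitaryThreeFourFrame
open Summit.HodgeConjecture.HodgeConjecture.Cruxes.H413.F0P3cDyRamFourFrameHSideDefs
open Summit.HodgeConjecture.HodgeConjecture.Cruxes.H413.F0P3cDyRamFourFrameHFamilyDefs
open scoped Matrix MatrixGroups Classical ValuativeRel
open Summit.HodgeConjecture.HodgeConjecture.Cruxes.H413.F0P3cDyRamFourFrameHSideDefsR
open Summit.HodgeConjecture.HodgeConjecture.Cruxes.H413.F0P3cDyRamFourFrameLawDefsR (shiftT shiftR)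
open Literature.NumberTheory.Automorphic.UnitaryLatticeTree Literature.NumberTheory.Automorphic.HermitianLattice
open Summit.HodgeConjecture.HodgeConjecture.Cruxes.H413

set_option maxHeartbeats 1600000 in
-- budget only: statement-heavy tokens (the :418 text and the eight ★ links' sockets are elaborated and unified once each).
/-- **(ρ2b′-X) THE TYPE-(2) FIXED-POINT CENSUS LAW AT THE ANCHOR** — the statement of U2H :418 `stub_U2H_fixedPointCensus_typeTwo_unit0` token for token (see the module
docstring): near `1 ∈ H_v`, for every `G`-regular type-(2) `γ_H`, every depth token `m` and symmetrised discriminant `β`, and every pair of matches `δ₊, δ₋` of κ-signs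
`+1, −1`, `(β, θ)_v · q_v^{−m} · (#Fix_{δ₊}(G_v ⧸ K_t) − #Fix_{δ₋}(G_v ⧸ K_t)) = #Fix_{γ₂}(U₂ ⧸ K_H) + d % 2 − 2(q_w^S − 1)∕(q_w − 1)`.  Proof: the (ρ2b′-X) pay line
(★ Pointwise ∘ ★ OfOrgansV3 ∘ ★ CensusOfFrameV3 ∘ ★ CensusOfLineModelsV3 ∘ ★ CensusOfLineModelsFin ∘ ★ CensusOfOrderFormsV3 ∘ ★ CensusOfOrderCountsV3 ∘ ★ TypeSplit) at the
three ★ typed order-count censuses. [cite: Rogawski1990, §4.9 Prop. 4.9.1 (b) p. 55, Lemma 4.9.3 p. 56] [cite: Kottwitz1986BaseChangeUnits, §1 pp. 240–241]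
[cite: LabesseLanglands1979, §2 p. 8] [cite: Serre1979, Ch. V §3 Prop. 5, Cor. 2–3 pp. 84–86] -/
theorem fixedPointCensus_typeTwo_unit0 :
    ∀ (L : Type) [Field L] [NumberField L] [IsCMField L]
      {v : HeightOneSpectrum (𝓞 ↥(maximalRealSubfield L))} (w : UnitaryGroup.PlacesOver L v)
      (hw : IsCMField.complexConj L • w.1 = w.1) (_he : v.asIdeal.ramificationIdx' w.1.asIdeal ≠ 1)
      (_h2 : ¬ IsUnit (2 : 𝒪[w.1.adicCompletion L]))
      (ϖ : (w.1.adicCompletion L)) (_hϖ : Valued.v ϖ = WithZero.exp (-1 : ℤ)) (d tE : ℕ) (_hD : IsRamifiedQuadraticDatum (galAdicCompletionMap (L := L) (IsCMField.complexConj L) hw) ϖ d tE)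
      [Fintype (Valued.ResidueField (w.1.adicCompletion L))]
      (N : Submodule (Valued.integer (w.1.adicCompletion L)) (Fin 3 → (w.1.adicCompletion L))) (_hN : IsVertexLattice (galAdicCompletionMap (L := L) (IsCMField.complexConj L) hw) ϖ ((StdForm.antidiagonal 3).over (w.1.adicCompletion L)) 0 N)
      (Kt : Subgroup ((UnitaryGroup.cmDatum L 3 (Matrix.of fun i j : Fin 3 => if i.val + j.val + 1 = 3 then (1 : L) else 0)).Local v)) (_hKt : ∀ u : ((UnitaryGroup.cmDatum L 3 (Matrix.of fun i j : Fin 3 => if i.val + j.val + 1 = 3 then (1 : L) else 0)).Local v), u ∈ Kt ↔ mapGL ((localNonsplitEquiv (IsCMField.complexConj L) (Matrix.of fun i j : Fin 3 => if i.val + j.val + 1 = 3 then (1 : L) else 0) (IsCMField.complexConj_ne_one L) w hw u :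
              ↥(unitaryGroupOfForm (galAdicCompletionMap (L := L) (IsCMField.complexConj L) hw) (placeForm (Matrix.of fun i j : Fin 3 => if i.val + j.val + 1 = 3 then (1 : L) else 0) w.1))) : GL (Fin 3) (w.1.adicCompletion L)) N = N),
      ∃ V ∈ 𝓝 (1 : ((UnitaryGroup.cmDatum L 2 (Matrix.of fun i j : Fin 2 => if i.val + j.val + 1 = 2 then (1 : L) else 0)).Local v × (UnitaryGroup.cmDatum L 1 (Matrix.of fun i j : Fin 1 => if i.val + j.val + 1 = 1 then (1 : L) else 0)).Local v)), ∀ γH ∈ V, IsLocalGRegular L v γH →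
              ¬ (∃ x : (w.1.adicCompletion L), (((((γH).1.val : GL (Fin 2) (UnitaryGroup.LocalRing L v)).val.map (Pi.evalRingHom (fun w' : UnitaryGroup.PlacesOver L v => w'.1.adicCompletion L) w))).charpoly).IsRoot x) →
              ∀ (m : ℕ) (β : (v.adicCompletion ↥(maximalRealSubfield L))ˣ), Valued.v (((finCharpolyTwo L v γH).eval (finGammaTwo L v γH)) w) = Valued.v ((toPlace v w (HeckeCharacter.uniformizer ↥(maximalRealSubfield L) v : v.adicCompletion ↥(maximalRealSubfield L))) ^ m) →
                toPlace v w (β : v.adicCompletion ↥(maximalRealSubfield L)) = -(((finCharpolyTwo L v γH).eval (finGammaTwo L v γH)) w * (finGammaTwo L v γH w ^ 2 + ((γH.1.val.val : Matrix (Fin 2) (Fin 2) (UnitaryGroup.LocalRing L v)).map (Pi.evalRingHom (fun w' : UnitaryGroup.PlacesOver L v => w'.1.adicCompletion L) w)).det)) / (2 * finGammaTwo L v γH w ^ 2 * ((γH.1.val.val : Matrix (Fin 2) (Fin 2) (UnitaryGroup.LocalRing L v)).map (Pi.evalRingHom (fun w' : UnitaryGroup.PlacesOver L v => w'.1.adicCompletion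 L) w)).det) →
              ∀ (δp δm : ((UnitaryGroup.cmDatum L 3 (Matrix.of fun i j : Fin 3 => if i.val + j.val + 1 = 3 then (1 : L) else 0)).Local v)), IsLocalNormPair L (Matrix.of fun i j : Fin 3 => if i.val + j.val + 1 = 3 then (1 : L) else 0) v γH δp → finKappaAt L v (Matrix.of fun i j : Fin 3 => if i.val + j.val + 1 = 3 then (1 : L) else 0) γH δp = 1 → IsLocalNormPair L (Matrix.of fun i j : Fin 3 => if i.val + j.val + 1 = 3 then (1 : L) else 0) v γH δm → finKappaAt L v (Matrix.of fun i j : Fin 3 => if i.val + j.val + 1 = 3 then (1 : L) else 0) γH δm = -1 →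
                (Literature.NumberTheory.QuadraticForms.hilbertSymbol (v.adicCompletion ↥(maximalRealSubfield L)) (β : v.adicCompletion ↥(maximalRealSubfield L)) (algebraMap ↥(maximalRealSubfield L) _ ((cmQuadraticGenerator L : 𝓞 ↥(maximalRealSubfield L)) : ↥(maximalRealSubfield L))) : ℂ) * (((Nat.card (𝓞 ↥(maximalRealSubfield L) ⧸ v.asIdeal) : ℂ) ^ m))⁻¹ *
                  ((Nat.card (MulAction.fixedBy (((UnitaryGroup.cmDatum L 3 (Matrix.of fun i j : Fin 3 => if i.val + j.val + 1 = 3 then (1 : L) else 0)).Local v) ⧸ Kt) δp) : ℂ) - (Nat.card (MulAction.fixedBy (((UnitaryGroup.cmDatum L 3 (Matrix.of fun i j : Fin 3 => if i.val + j.val + 1 = 3 then (1 : L) else 0)).Local v) ⧸ Kt) δm) : ℂ)) =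
                ((Nat.card (MulAction.fixedBy (((UnitaryGroup.cmDatum L 2 (Matrix.of fun i j : Fin 2 => if i.val + j.val + 1 = 2 then (1 : L) else 0)).Local v) ⧸ cmLocalIntegralLevel L 2 (Matrix.of fun i j : Fin 2 => if i.val + j.val + 1 = 2 then (1 : L) else 0) v) γH.1) : ℂ) + ((d % 2 : ℕ) : ℂ)) - 2 * (((Fintype.card (Valued.ResidueField (w.1.adicCompletion L)) : ℕ) : ℂ) ^ (shiftR d tE) - 1) / (((Fintype.card (Valued.ResidueField (w.1.adicCompletion L)) : ℕ) : ℂ) - 1) :=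
  fun L _ _ _ _ w hw he h2 ϖ hϖ d tE hD _ N hN Kt hKt =>
    -- `h2v : |2|_w < 1` = :418's `_h2 : ¬ IsUnit (2 : 𝒪[L_w])` (valuative-relation integers) read through the `Valued`∕`ValuativeRel` compatibility
    have h2v : Valued.v (2 : w.1.adicCompletion L) < 1 :=
      (Valuation.vlt_one_iff (Valued.v : Valuation (w.1.adicCompletion L) (WithZero (Multiplicative ℤ)))).1
        ((Valuation.vlt_one_iff (ValuativeRel.valuation (w.1.adicCompletion L))).2 (Valuation.Integer.not_isUnit_iff_valuation_lt_one.mp h2))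
    F0P3cDyRamFixedPointCensusTypeTwoPointwise.fixedPointCensus_typeTwo_unit0_at_of_signedCensusNV_at L w hw he ϖ hϖ d tE
      (F0P3cDyRamFixedPointCensusTypeTwoOfOrgansV3.hOrgNV_at_of_census3 L w hw he ϖ d tE hD
        (F0P3cDyRamFixedPointCensusTypeTwoCensusOfFrameV3.hCensus3_at_of_frameCensus3 L w hw ϖ d
          (F0P3cDyRamFixedPointCensusTypeTwoCensusOfLineModelsV3.frameCensus3_of_lineModelCensus2 L w hw ϖ hϖ d
            (F0P3cDyRamFixedPointCensusTypeTwoCensusOfLineModelsFin.lineModelCensus_of_lineModelCensusFin L w hw ϖ hϖ d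
              (F0P3cDyRamFixedPointCensusTypeTwoCensusOfOrderFormsV3.lineModelCensus3_of_orderFormCensus3 L w hw ϖ hϖ d
                (F0P3cDyRamFixedPointCensusTypeTwoCensusOfOrderCountsV3.orderFormCensus3_of_orderCountCensus2 L w hw ϖ hϖ d tE hD h2v
                  (F0P3cDyRamFixedPointCensusTypeTwoTypeSplit.orderCountCensus2_of_types L w hw he ϖ d
                    (F0P3cDyRamOrderCountCensusUnr.orderCountCensusA L w hw he ϖ hϖ d tE hD h2v)
                    (F0P3cDyRamOrderCountCensusRamK.orderCountCensusB L w hw he ϖ hϖ d tE hD h2v)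
                    (F0P3cDyRamOrderCountCensusRamM.orderCountCensusC L w hw he ϖ hϖ d tE hD h2v)))))))) N hN Kt hKt

end Summit.HodgeConjecture.HodgeConjecture.Cruxes.H413.F0P3cDyRamFixedPointCensusTypeTwo

end
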